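import Summits.Parity.GeneralizedHardyLittlewood.Theses.PrimeLevelFamEdge
import Literature.NumberTheory.LFunctions.KMVMomentsToHalfEdgeAtOne
import HarnessLib

/-!
# LEAD g2 — RESTATEMENT KIT for crux stmt-Parity-20007 at `Q = 1` (crux workfile; planner-facing; NOT a registered line)

Kernel demonstration that the route `PrimeLevelFamEdge` re-glues with the crux K_A and the antecedent of K_B stated AT `Q = 1`
ONLY (the value every consumer uses). Contents:
* `MomentAsymptoticsAtOne Δlo Δhi T₁ T₂` — the two KMV displays at `Q = 1` (candidate Literature definition; here local);
* `MomentsBeyondDiagonalAtOne` (K_A¹) and `momentsBeyondDiagonalAtOne_of` : K_A → K_A¹ (projection);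
* `BeyondDiagonalBeatsQuarterAtOne` (K_B¹: same value statement, antecedent K_A¹-shaped);
* `closes_atOne` : K_A¹ → K_B¹ → FirstMomentPrinted → TwistNonneg → TwistedHalfPrintedSqfreeLevel → MixedMomentPrintedSqfreeLevel →
  PeterssonBoundPrinted → `Zhang2022.Skeleton.Theorem1` — the deciding chain, verbatim from `closes` except that the conversion is the
  pointwise twin `primeLevelFamilyTwo_EStarFam_of_displaysAtOne_pb` (Literature, p635047). Sorry-free.
What this shows: restating K_A at `Q = 1` costs the route nothing; what it buys: the line's `stub_first` / `stub_identP` are then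
tree theorems by name (p634240 / p634139), `stub_diag` needs only `W₀₀ = cutoffW`. What it does NOT do: prove K_A¹ (open, famE-02),
K_B¹, or anything about Landau–Siegel zeros.
-/

noncomputable section

open scoped Real
open Polynomial
open Literature.NumberTheory.LFunctions

namespace Summit.Parity.GeneralizedHardyLittlewood.Cruxes.MomentsBeyondDiagonal.RestatementAtOne

open Summit.Parity.GeneralizedHardyLittlewood.Theses.PrimeLevelFamEdge

/-- The KMV moment asymptotics AT `Q = 1` on the window `(Δlo, Δhi]` with level-free extra main-term functionals `T₁, T₂` of
`(Δ, P)`: both displays of `KMV2000.MomentAsymptotics` specialised to `Q = 1`. -/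
def MomentAsymptoticsAtOne (Δlo Δhi : ℝ) (T₁ T₂ : ℝ → ℝ[X] → ℝ) : Prop :=
  ∀ P : ℝ[X], KMV2000.Admissible P → ∀ Δ : ℝ, Δlo < Δ → Δ ≤ Δhi →
    ∃ C : ℝ, ∃ q₀ : ℕ, ∀ (q : ℕ) [NeZero q], q.Prime → q₀ ≤ q →
      (∀ n : ℕ, (n : ℝ) ≠ KMV2000.qhat q ^ Δ) →
        ‖KMV2000.LhPQ q P 1 (KMV2000.qhat q ^ Δ) -
            ((riemannZeta 2 * ((Real.sqrt (KMV2000.qhat q) / (Δ * Real.log (KMV2000.qhat q)) : ℝ) : ℂ)) *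
              ((KMV2000.linForm Δ P 1 + T₁ Δ P : ℝ) : ℂ))‖ ≤
          C * Real.sqrt (KMV2000.qhat q) * (Real.log (KMV2000.qhat q))⁻¹ ^ 2 ∧
        ‖KMV2000.QhPQ q P 1 (KMV2000.qhat q ^ Δ) -
            ((2 * riemannZeta 2 ^ 2 * ((KMV2000.qhat q / (Δ ^ 2 * Real.log (KMV2000.qhat q) ^ 2) : ℝ) : ℂ)) *
              ((KMV2000.secondMomentForm Δ P 1 + T₂ Δ P : ℝ) : ℂ))‖ ≤
          C * KMV2000.qhat q * (Real.log (KMV2000.qhat q))⁻¹ ^ 3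

/-- K_A¹: the crux restated at `Q = 1`. -/
def MomentsBeyondDiagonalAtOne : Prop :=
  ∃ Δ : ℝ, 1 < Δ ∧ ∃ T₁ T₂ : ℝ → ℝ[X] → ℝ, MomentAsymptoticsAtOne 1 Δ T₁ T₂

/-- The registered K_A implies K_A¹ (projection to `Q = 1`). -/
theorem momentsBeyondDiagonalAtOne_of (h : MomentsBeyondDiagonal) : MomentsBeyondDiagonalAtOne := by
  obtain ⟨Δ, hΔ, T₁, T₂, hMA⟩ := h
  refine ⟨Δ, hΔ, fun Δ' P ↦ T₁ Δ' P 1, fun Δ' P ↦ T₂ Δ' P 1, fun P hP Δ' h1 h2 ↦ ?_⟩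
  exact hMA P 1 hP KMV2000.isEvenOrOdd_one Δ' h1 h2

/-- K_B¹: the value crux with its antecedent restated at `Q = 1` (same conclusion as `BeyondDiagonalBeatsQuarter`). -/
def BeyondDiagonalBeatsQuarterAtOne : Prop :=
  Literature.NumberTheory.LFunctions.bettin2017_theorem11_primeLevel → ∀ Δ : ℝ, 1 < Δ → ∀ T₁ T₂ : ℝ → ℝ[X] → ℝ,
    MomentAsymptoticsAtOne 1 Δ T₁ T₂ → ∃ a b : ℝ, 1 ≤ a ∧ a < b ∧ b ≤ Δ ∧ a < 3 / 2 ∧ ∃ P : ℝ[X],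
      KMV2000.Admissible P ∧ ∀ Δ' : ℝ, a < Δ' → Δ' < b →
        1 / 4 < (KMV2000.linForm Δ' P 1 + T₁ Δ' P) ^ 2 / (2 * (KMV2000.secondMomentForm Δ' P 1 + T₂ Δ' P))

/-- **The deciding chain at `Q = 1`** (verbatim from `PrimeLevelFamEdge.closes`, conversion through the pointwise twin
`CentralValueFamilyHalfEdge.primeLevelFamilyTwo_EStarFam_of_displaysAtOne_pb`). -/
theorem closes_atOne (hA : MomentsBeyondDiagonalAtOne) (hB : BeyondDiagonalBeatsQuarterAtOne) (hF : FirstMomentPrinted)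
    (hLR : TwistNonneg) (hTw : TwistedHalfPrintedSqfreeLevel) (hMix : MixedMomentPrintedSqfreeLevel)
    (hP : PeterssonBoundPrinted) :
    Literature.NumberTheory.LFunctions.Zhang2022.Skeleton.Theorem1 := by
  have hE : FamEdgeWeightTwo := by
    obtain ⟨Δ, hΔ, T₁, T₂, hMA⟩ := hA
    obtain ⟨a, b, ha1, hab, hbΔ, ha32, P, hPadm, hval⟩ := hB hF Δ hΔ T₁ T₂ hMA
    have hab' : a < min b (3 / 2) := lt_min hab ha32
    obtain ⟨Δ', ⟨haΔ', hΔ'b⟩, hgen⟩ :=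
      Literature.NumberTheory.LFunctions.KMV2000.exists_mem_Ioo_qhat_rpow_ne_nat hab'
    have hΔ'b' : Δ' < b := lt_of_lt_of_le hΔ'b (min_le_left _ _)
    have hΔ'32 : Δ' < 3 / 2 := lt_of_lt_of_le hΔ'b (min_le_right _ _)
    have h1Δ' : 1 < Δ' := lt_of_le_of_lt ha1 haΔ'
    have hΔ'0 : 0 < Δ' := by linarith
    have hR := hval Δ' haΔ' hΔ'b'
    have hc₂ : 0 < Literature.NumberTheory.LFunctions.KMV2000.secondMomentForm Δ' P 1 + T₂ Δ' P := by
      by_contra h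
      have h := not_lt.1 h
      have : (Literature.NumberTheory.LFunctions.KMV2000.linForm Δ' P 1 + T₁ Δ' P) ^ 2 /
          (2 * (Literature.NumberTheory.LFunctions.KMV2000.secondMomentForm Δ' P 1 + T₂ Δ' P)) ≤ 0 :=
        div_nonpos_of_nonneg_of_nonpos (sq_nonneg _) (by linarith)
      linarith
    exact Literature.NumberTheory.LFunctions.CentralValueFamilyHalfEdge.primeLevelFamilyTwo_EStarFam_of_displaysAtOne_pb
      hP hLR (hMA P hPadm Δ' h1Δ' (le_trans hΔ'b'.le hbΔ)) hΔ'0 ⟨40, fun q _ hq ↦ hgen q hq⟩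
      (Literature.NumberTheory.LFunctions.KMV2000.mollifierNormBound_of_petersson_pb hP P hΔ'0 hΔ'32) hc₂ hR
  obtain ⟨p₁, hp, hEp⟩ := hE
  have h4 : Literature.NumberTheory.LFunctions.Zhang2022.Skeleton.LOneLowerBound 4 := by
    refine Literature.NumberTheory.LFunctions.CentralValueFamilyHalfEdge.lOneLowerBound_of_eventual ?_
    obtain ⟨c, hc, D₀, h⟩ :=
      Literature.NumberTheory.LFunctions.CentralValueFamilyHalfEdge.lOne_lowerBound_of_EStarFam_prime_weightTwo'_pb_sqfreeLevel
        hLR hTw hMix hP hp hEp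
    exact ⟨c, hc, D₀, fun D _ χ hD hprim hquad => h D χ hD hprim hquad⟩
  exact Literature.NumberTheory.LFunctions.Zhang2022.Section1.lOneLowerBound_mono (by norm_num) h4

end Summit.Parity.GeneralizedHardyLittlewood.Cruxes.MomentsBeyondDiagonal.RestatementAtOne

end
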